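import Literature.MathematicalPhysics.StatisticalMechanics.Theil2006LatticeWalks
import Literature.MathematicalPhysics.StatisticalMechanics.Theil2006DiscreteImbedding
import HarnessLib

/-!
# Theil 2006, §4.2 (proof of Proposition 4.8, (64) with Lemma 4.6): continuation of local
discrete imbeddings along realized lattice walks, without monodromy

Topic `Literature/MathematicalPhysics/StatisticalMechanics`; companion of `Theil2006.lean`
(F. Theil, *A proof of crystallization in two dimensions*, Comm. Math. Phys. **262** (2006)
209–236, accepted preprint of 26 Aug 2005), Appendix §4.2. Everything here is PROVED; the
`def`s are plain definitions with bodies.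

## Source, as printed (preprint p. 21), and what this file proves

In the proof of Proposition 4.8 the discrete imbedding `Φ` of a large patch is DEFINED by path
sums (64) `Φ(x) = Σ_k R^{Σ_{j<k} r(γ_x(j))} e₁` along discrete paths `γ_x` from a base particle,
and «Lemma 4.6 implies that the definition of `Φ(x)` is independent of the choice of `γ_x`».
This file proves the corresponding statement in the form in which our construction of discrete
imbeddings uses it. Suppose every particle `b` with `|y(b) − y(p₀)| < ρ` is CHARTED
(`Theil2006.IsCharted`): it has a hexagonal neighbourhood (Lemma 4.7, `IsHexagonalNbhd`) on which
the label map `Φ : X → ℤ²` is a discrete imbedding (Definition 2.4) — a purely local hypothesis,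
with no injectivity of `Φ` beyond single neighbourhoods. A lattice walk `l` (steps in
`unitShell`) is REALIZED from `p₀` by following, at each step `u`, the bond to the neighbour whose
label is the current label plus `u` (`Theil2006.realize`). Then:

* `Theil2006.realize_invariant`: the realization of walks of length `≤ L` is invariant under the
  two elementary moves of `Theil2006.WalkEquiv` (backtrack `u, −u ↦ ∅`, triangle `u ↦ v, w`),
  as long as `(L − 1)(1 + α) < ρ` — the moves are performed inside single charted wheels;
* `Theil2006.realize_eq_realize_outWalk` (**path independence**): if `(n + 1)(1 + α) < ρ`, every
  walk inside the label ball `{η : hexNorm(η − Φ(p₀)) ≤ n}` realizes to the same particle as the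
  canonical walk to its endpoint — by the simple connectivity of hexagonal label balls
  (`Theil2006.outWalk_confluence`, the combinatorial Lemma 4.6 of `Theil2006LatticeWalks`),
  applied through SHORT detours only (this is why `WalkEquiv` records the detour length);
* `Theil2006.isDiscreteImbeddingOn_reach` (**injectivity in the large from injectivity in the
  small**): `Φ` is a discrete imbedding of the set `Theil2006.reach p₀ n` of particles reached
  from `p₀` by realizing the walks of the label ball of radius `n` — two of them with the same
  label are both the realization of the canonical walk to it; bond chains through charted
  particles with labels in that ball land in `reach` (`Theil2006.chainEnd_mem_reach`), and so
  do the neighbourhoods of realized labels (`Theil2006.realize_outWalk_spec`, the input for the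
  lower half of (61)).

[cite: Theil2006, §4.2 proof of Proposition 4.8, (64) with Lemma 4.6 and Lemma 4.7 (preprint
pp. 20–21); our combinatorial form — the label ball replaces the Jordan domain `Ω(γ)`]
-/

namespace Literature.MathematicalPhysics.StatisticalMechanics

namespace Theil2006

open Metric

/-! ### Charted particles: hexagonal wheels carrying a local discrete imbedding -/

section Charts

variable {X : Type*} {α : ℝ} {y : X → Plane} {Φ : X → ℤ × ℤ} {q : X}

/-- A particle `q` is **charted** by the label map `Φ` if `q` has a hexagonal neighbourhood
(Lemma 4.7) and `Φ` restricted to `𝒩(q)` is a discrete imbedding (Definition 2.4).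
[cite: Theil2006, §4.2 Lemma 4.7 and proof of Proposition 4.8 (64) (preprint pp. 20–21); our bookkeeping] -/
def IsCharted (α : ℝ) (y : X → Plane) (Φ : X → ℤ × ℤ) (q : X) : Prop :=
  (∃ p : Fin 6 → X, IsHexagonalNbhd α y q p) ∧ IsDiscreteImbeddingOn α y (nbhdSet α y q) Φ

/-- A charted particle is not a defect. [cite: Theil2006, §4.2 Lemma 4.7 (preprint p. 20)] -/
theorem IsCharted.not_mem_defectSet (hq : IsCharted α y Φ q) (hα : α < 1) : q ∉ defectSet α y := by
  obtain ⟨⟨p, H⟩, _⟩ := hq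
  exact H.not_mem_defectSet hα

/-- Around a charted particle every unit label step is carried by a bond (Remark 2.5: the six
neighbours go onto the six lattice neighbours). [cite: Theil2006, §2.3 Remark 2.5 (preprint p. 7)] -/
theorem IsCharted.exists_isShortRange_apply_eq (hq : IsCharted α y Φ q) (hα : α < 1) {u : ℤ × ℤ}
    (hu : u ∈ unitShell) : ∃ b, IsShortRange α y q b ∧ Φ b = Φ q + u := by
  have himg := hq.2.image_neighbours_eq hα (hq.not_mem_defectSet hα) subset_rfl
  have hmem : Φ q + u ∈ {k' : ℤ × ℤ | dist (triPoint (Φ q)) (triPoint k') = 1} := by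
    show dist (triPoint (Φ q)) (triPoint (Φ q + u)) = 1
    rw [dist_comm, dist_triPoint, add_sub_cancel_left]
    exact norm_triPoint_of_mem_unitShell hu
  rw [← himg] at hmem
  obtain ⟨b, hb, hbu⟩ := hmem
  exact ⟨b, hb, hbu⟩

/-- Around a charted particle, labels determine neighbours. [cite: Theil2006, §2.3 Definition 2.4 (injectivity) (preprint p. 7)] -/
theorem IsCharted.eq_of_isShortRange (hq : IsCharted α y Φ q) {b b' : X} (hb : IsShortRange α y q b)
    (hb' : IsShortRange α y q b') (h : Φ b = Φ b') : b = b' :=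
  hq.2.injOn hb.mem_nbhdSet hb'.mem_nbhdSet h

/-- Around a charted particle, bonds carry unit label steps (Remark 2.5 "⇒"). [cite: Theil2006, §2.3 Remark 2.5 (preprint p. 7)] -/
theorem IsCharted.sub_mem_unitShell (hq : IsCharted α y Φ q) (hα : α < 1) {b : X}
    (hb : IsShortRange α y q b) : Φ b - Φ q ∈ unitShell :=
  hq.2.sub_mem_unitShell hα (mem_nbhdSet_self q) hb.mem_nbhdSet hb

/-- `(i + 5) + 1 = i` in `Fin 6`. [folklore] -/
private theorem fin6_add_five_add_one' (i : Fin 6) : i + 5 + 1 = i := by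
  rw [add_assoc, show (5 : Fin 6) + 1 = 0 from rfl, add_zero]

/-- **Rim adjacency is read off the labels.** Two neighbours `b, b′` of a charted particle whose
labels differ by a unit vector form a short-range pair: the two rim particles adjacent to `b`
along the hexagon carry the only two lattice neighbours of `Φ(q)` adjacent to `Φ(b)`, and `Φ`
is injective on the wheel. [cite: Theil2006, §4.2 Lemma 4.7 with §2.3 Remark 2.5 (preprint pp. 7, 20); our lemma] -/
theorem IsCharted.isShortRange_of_sub_mem_unitShell (hq : IsCharted α y Φ q) (hα : α < 1)
    {b b' : X} (hb : IsShortRange α y q b) (hb' : IsShortRange α y q b')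
    (hadj : Φ b' - Φ b ∈ unitShell) : IsShortRange α y b b' := by
  obtain ⟨⟨p, H⟩, hΦ⟩ := hq
  obtain ⟨i, rfl⟩ := H.mem_range_of_isShortRange hb
  obtain ⟨j, rfl⟩ := H.mem_range_of_isShortRange hb'
  have hq0 : q ∈ nbhdSet α y q := mem_nbhdSet_self q
  have hmem : ∀ k, p k ∈ nbhdSet α y q := fun k => (H.isShortRange_centre k).mem_nbhdSet
  have hunit : ∀ k, Φ (p k) - Φ q ∈ unitShell := fun k =>
    hΦ.sub_mem_unitShell hα hq0 (hmem k) (H.isShortRange_centre k)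
  have hstep : ∀ k k', Φ (p k') - Φ (p k) ∈ unitShell →
      Φ (p k') - Φ q = rot60 (Φ (p k) - Φ q) ∨ Φ (p k') - Φ q = rot60^[5] (Φ (p k) - Φ q) := by
    intro k k' hs
    refine eq_rot60_or_eq_rot60_iterate_five (hunit k) (hunit k') ?_
    rwa [sub_sub_sub_cancel_right]
  have h1 := hstep i (i + 1) (hΦ.sub_mem_unitShell hα (hmem _) (hmem _) (H.isShortRange_succ i))
  have h5 := hstep i (i + 5) (hΦ.sub_mem_unitShell hα (hmem _) (hmem _) (by
    have := H.isShortRange_succ (i + 5)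
    rw [fin6_add_five_add_one'] at this
    exact this.symm))
  have hj := hstep i j hadj
  have hne : Φ (p (i + 1)) - Φ q ≠ Φ (p (i + 5)) - Φ q := by
    intro h
    have h' := H.injective (hΦ.injOn (hmem _) (hmem _) (sub_left_injective h))
    exact absurd (add_left_cancel h') (by decide)
  have hj' : Φ (p j) = Φ (p (i + 1)) ∨ Φ (p j) = Φ (p (i + 5)) := by
    rcases hj with hj | hj <;> rcases h1 with h1 | h1 <;> rcases h5 with h5 | h5 <;>
      first
      | exact Or.inl (sub_left_injective (hj.trans h1.symm))
      | exact Or.inr (sub_left_injective (hj.trans h5.symm))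
      | exact absurd (h1.trans h5.symm) hne
  rcases hj' with h | h
  · rw [H.injective (hΦ.injOn (hmem _) (hmem _) h)]
    exact H.isShortRange_succ i
  · rw [H.injective (hΦ.injOn (hmem _) (hmem _) h)]
    have := H.isShortRange_succ (i + 5)
    rw [fin6_add_five_add_one'] at this
    exact this.symm

end Charts

/-! ### Realized walks -/

section Realize

variable {X : Type*}

open Classical in
/-- **One continuation step**: from `q`, the neighbour of `q` carrying the label `η` (if there is
one; otherwise stay at `q`). [cite: Theil2006, §4.2 proof of Proposition 4.8 (64) (preprint p. 21); our bookkeeping] -/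
noncomputable def nextP (α : ℝ) (y : X → Plane) (Φ : X → ℤ × ℤ) (q : X) (η : ℤ × ℤ) : X :=
  if h : ∃ b, IsShortRange α y q b ∧ Φ b = η then h.choose else q

/-- **The realization of a lattice walk** from a particle: follow, step by step, the bond carrying
the prescribed label increment. [cite: Theil2006, §4.2 proof of Proposition 4.8 (64) («Let γ_x be
a discrete path …», preprint p. 21); our bookkeeping] -/
noncomputable def realize (α : ℝ) (y : X → Plane) (Φ : X → ℤ × ℤ) : X → List (ℤ × ℤ) → X
  | q, [] => q
  | q, u :: l => realize α y Φ (nextP α y Φ q (Φ q + u)) l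

variable {α : ℝ} {y : X → Plane} {Φ : X → ℤ × ℤ}

/-- The empty walk stays put. [cite: Theil2006, §4.2 proof of Proposition 4.8 (64) (preprint p. 21); our bookkeeping] -/
@[simp] theorem realize_nil (q : X) : realize α y Φ q [] = q := rfl

/-- One step, then the rest. [cite: Theil2006, §4.2 proof of Proposition 4.8 (64) (preprint p. 21); our bookkeeping] -/
theorem realize_cons (q : X) (u : ℤ × ℤ) (l : List (ℤ × ℤ)) :
    realize α y Φ q (u :: l) = realize α y Φ (nextP α y Φ q (Φ q + u)) l := rfl

/-- Realizing a concatenation: realize the first walk, then the second from where it ends.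
[cite: Theil2006, §4.2 proof of Proposition 4.8 (64) (preprint p. 21); our bookkeeping] -/
theorem realize_append (q : X) (l s : List (ℤ × ℤ)) :
    realize α y Φ q (l ++ s) = realize α y Φ (realize α y Φ q l) s := by
  induction l generalizing q with
  | nil => rfl
  | cons u l ih => exact ih _

variable {q : X}

/-- At a charted particle every unit step is realized by a bond with the right label.
[cite: Theil2006, §2.3 Remark 2.5 (preprint p. 7)] -/
theorem IsCharted.nextP_spec (hq : IsCharted α y Φ q) (hα : α < 1) {u : ℤ × ℤ} (hu : u ∈ unitShell) :
    IsShortRange α y q (nextP α y Φ q (Φ q + u)) ∧ Φ (nextP α y Φ q (Φ q + u)) = Φ q + u := by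
  have h : ∃ b, IsShortRange α y q b ∧ Φ b = Φ q + u := hq.exists_isShortRange_apply_eq hα hu
  classical
  rw [nextP, dif_pos h]
  exact h.choose_spec

/-- At a charted particle the step to a prescribed label is the neighbour carrying it.
[cite: Theil2006, §2.3 Definition 2.4 (injectivity) (preprint p. 7)] -/
theorem IsCharted.nextP_eq (hq : IsCharted α y Φ q) {b : X} {η : ℤ × ℤ} (hb : IsShortRange α y q b)
    (hbe : Φ b = η) : nextP α y Φ q η = b := by
  have h : ∃ b, IsShortRange α y q b ∧ Φ b = η := ⟨b, hb, hbe⟩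
  classical
  rw [nextP, dif_pos h]
  exact hq.eq_of_isShortRange h.choose_spec.1 hb (h.choose_spec.2.trans hbe.symm)

end Realize

/-! ### Continuation inside a charted region -/

section Region

variable {X : Type*} {α : ℝ} {y : X → Plane} {Φ : X → ℤ × ℤ} {p₀ : X} {ρ : ℝ}

/-- **Tracking a realized walk.** If every particle within `ρ` of `y(p₀)` is charted and
`(length − 1)(1 + α) < ρ`, the realization of a lattice walk is a bond chain: it ends within
`length · (1 + α)` of `y(p₀)` and carries the label `Φ(p₀) + Σ l`.
[cite: Theil2006, §4.2 proof of Proposition 4.8 (64) (preprint p. 21); our bookkeeping] -/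
theorem realize_track (hS : ∀ b, dist (y b) (y p₀) < ρ → IsCharted α y Φ b) (hα0 : 0 ≤ α)
    (hα : α < 1) {l : List (ℤ × ℤ)} (hl : IsWalk l) (hlen : ((l.length : ℝ) - 1) * (1 + α) < ρ) :
    dist (y (realize α y Φ p₀ l)) (y p₀) ≤ l.length * (1 + α) ∧
      Φ (realize α y Φ p₀ l) = Φ p₀ + l.sum := by
  induction l using List.reverseRecOn with
  | nil => simp
  | append_singleton l u ih =>
    rw [isWalk_append, isWalk_cons] at hl
    rw [List.length_append, List.length_singleton, Nat.cast_add, Nat.cast_one] at hlen ⊢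
    have hlen' : ((l.length : ℝ) - 1) * (1 + α) < ρ := by nlinarith
    obtain ⟨hd, hlab⟩ := ih hl.1 hlen'
    have hr : IsCharted α y Φ (realize α y Φ p₀ l) := hS _ (by nlinarith)
    obtain ⟨hs, hlab'⟩ := hr.nextP_spec hα hl.2.1
    rw [realize_append, realize_cons, realize_nil]
    refine ⟨?_, ?_⟩
    · calc dist (y (nextP α y Φ (realize α y Φ p₀ l) (Φ (realize α y Φ p₀ l) + u))) (y p₀)
            ≤ dist (y (nextP α y Φ (realize α y Φ p₀ l) (Φ (realize α y Φ p₀ l) + u)))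
                (y (realize α y Φ p₀ l)) + dist (y (realize α y Φ p₀ l)) (y p₀) := dist_triangle _ _ _
        _ ≤ (1 + α) + l.length * (1 + α) := by
            gcongr
            rw [dist_comm]; exact hs.dist_le
        _ = (l.length + 1) * (1 + α) := by ring
    · rw [hlab', hlab, List.sum_append, List.sum_cons, List.sum_nil, add_zero, add_assoc]

/-- **Move-invariance of realization.** In a charted region of radius `ρ` around `y(p₀)` with
`(L − 1)(1 + α) < ρ`, `L`-move-equivalent walks realize to the same particle: a backtrack
`u, −u` returns along the same bond, and the two routes `u` and `v, w` around a unit triangle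
end at the same particle — both inside one charted wheel (Lemma 4.7, Remark 2.5).
[cite: Theil2006, §4.2 proof of Proposition 4.8 (64) with Lemma 4.6 (preprint p. 21); our combinatorial form] -/
theorem realize_invariant (hS : ∀ b, dist (y b) (y p₀) < ρ → IsCharted α y Φ b) (hα0 : 0 ≤ α)
    (hα : α < 1) {c : ℤ × ℤ} {n L : ℕ} (hL : ((L : ℝ) - 1) * (1 + α) < ρ) {l l' : List (ℤ × ℤ)}
    (h : WalkEquiv c n L (Φ p₀) l l') : realize α y Φ p₀ l = realize α y Φ p₀ l' := by
  refine h.invariant (realize α y Φ p₀) ?_ ?_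
  · intro l₁ l₂ u hu h1 _ _ hlen
    rw [List.length_append, List.length_cons, List.length_cons] at hlen
    have hlen1 : ((l₁.length : ℝ) - 1) * (1 + α) < ρ := by
      have : (l₁.length : ℝ) + 2 ≤ L := by exact_mod_cast (show l₁.length + 2 ≤ L by omega)
      nlinarith
    obtain ⟨hd, -⟩ := realize_track hS hα0 hα h1 hlen1
    set r := realize α y Φ p₀ l₁ with hr_def
    have hr : IsCharted α y Φ r := hS _ (by
      have : (l₁.length : ℝ) + 2 ≤ L := by exact_mod_cast (show l₁.length + 2 ≤ L by omega)
      nlinarith)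
    obtain ⟨hs, hlab⟩ := hr.nextP_spec hα hu
    set q := nextP α y Φ r (Φ r + u) with hq_def
    have hq : IsCharted α y Φ q := hS _ (by
      have : (l₁.length : ℝ) + 2 ≤ L := by exact_mod_cast (show l₁.length + 2 ≤ L by omega)
      calc dist (y q) (y p₀) ≤ dist (y q) (y r) + dist (y r) (y p₀) := dist_triangle _ _ _
        _ ≤ (1 + α) + l₁.length * (1 + α) := by
            gcongr
            rw [dist_comm]; exact hs.dist_le
        _ < ρ := by nlinarith)
    have hback : nextP α y Φ q (Φ q + -u) = r :=
      hq.nextP_eq hs.symm (by rw [hlab]; abel)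
    rw [realize_append, realize_append, realize_cons, realize_cons, ← hr_def, ← hq_def, hback]
  · intro l₁ l₂ u v w hu hv hw hvw h1 _ _ _ hlen
    rw [List.length_append, List.length_cons, List.length_cons] at hlen
    have hlen1 : ((l₁.length : ℝ) - 1) * (1 + α) < ρ := by
      have : (l₁.length : ℝ) + 2 ≤ L := by exact_mod_cast (show l₁.length + 2 ≤ L by omega)
      nlinarith
    obtain ⟨hd, -⟩ := realize_track hS hα0 hα h1 hlen1
    set r := realize α y Φ p₀ l₁ with hr_def
    have hr : IsCharted α y Φ r := hS _ (by
      have : (l₁.length : ℝ) + 2 ≤ L := by exact_mod_cast (show l₁.length + 2 ≤ L by omega)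
      nlinarith)
    obtain ⟨hsq, hlabq⟩ := hr.nextP_spec hα hu
    obtain ⟨hss, hlabs⟩ := hr.nextP_spec hα hv
    set q := nextP α y Φ r (Φ r + u) with hq_def
    set s := nextP α y Φ r (Φ r + v) with hs_def
    have hsc : IsCharted α y Φ s := hS _ (by
      have : (l₁.length : ℝ) + 2 ≤ L := by exact_mod_cast (show l₁.length + 2 ≤ L by omega)
      calc dist (y s) (y p₀) ≤ dist (y s) (y r) + dist (y r) (y p₀) := dist_triangle _ _ _
        _ ≤ (1 + α) + l₁.length * (1 + α) := by
            gcongr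
            rw [dist_comm]; exact hss.dist_le
        _ < ρ := by nlinarith)
    have hadj : Φ q - Φ s ∈ unitShell := by
      rw [hlabq, hlabs, ← hvw]; convert hw using 1; abel
    have hsq' : IsShortRange α y s q := hr.isShortRange_of_sub_mem_unitShell hα hss hsq hadj
    have htri : nextP α y Φ s (Φ s + w) = q :=
      hsc.nextP_eq hsq' (by rw [hlabq, hlabs, ← hvw, add_assoc])
    rw [realize_append, realize_append, realize_cons, realize_cons, realize_cons, ← hr_def,
      ← hq_def, ← hs_def, htri]

/-- **Path independence (Lemma 4.6 ⇒ (64) is well defined).** In a charted region of radius `ρ`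
around `y(p₀)` with `(n + 1)(1 + α) < ρ`, every lattice walk inside the label ball
`{η : hexNorm(η − Φ(p₀)) ≤ n}` realizes from `p₀` to the same particle as the canonical outward
walk to its endpoint. Induction on the walk from the right; the last step is absorbed by the local
confluence of canonical walks (`outWalk_confluence`), a move-equivalence through walks of length
`≤ n + 2`, all realized inside the charted region. [cite: Theil2006, §4.2 proof of Proposition
4.8 (64) with Lemma 4.6 (preprint pp. 20–21); our combinatorial form] -/
theorem realize_eq_realize_outWalk (hS : ∀ b, dist (y b) (y p₀) < ρ → IsCharted α y Φ b)
    (hα0 : 0 ≤ α) (hα : α < 1) {n : ℕ} (hn : ((n : ℝ) + 1) * (1 + α) < ρ) {l : List (ℤ × ℤ)}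
    (hl : IsWalk l) (hb : InBall (Φ p₀) n (Φ p₀) l) :
    realize α y Φ p₀ l = realize α y Φ p₀ (outWalk (Φ p₀) (Φ p₀ + l.sum)) := by
  induction l using List.reverseRecOn with
  | nil =>
    have h0 : outWalk (Φ p₀) (Φ p₀ + ([] : List (ℤ × ℤ)).sum) = [] := by
      apply List.eq_nil_of_length_eq_zero
      rw [length_outWalk, List.sum_nil, add_zero, sub_self]
      simp [hexNorm]
    rw [h0]
  | append_singleton l u ih =>
    rw [isWalk_append, isWalk_cons] at hl
    rw [inBall_append] at hb
    set c := Φ p₀ with hc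
    set b' := c + l.sum with hb'_def
    have hbn' : hexNorm (b' - c) ≤ n := hb.2.start
    have hbn : hexNorm (b' + u - c) ≤ n := by
      have := hb.2.last
      simpa using this
    have h1 : realize α y Φ p₀ (l ++ [u]) = realize α y Φ p₀ (outWalk c b' ++ [u]) := by
      rw [realize_append, ih hl.1 hb.1, ← realize_append]
    have h2 : WalkEquiv c n (n + 2) c (outWalk c b' ++ [b' + u - b']) (outWalk c (b' + u)) :=
      outWalk_confluence hbn hbn' (by simpa using hl.2.1)
    rw [add_sub_cancel_left] at h2
    have h3 := realize_invariant hS hα0 hα (c := c) (n := n) (L := n + 2)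
      (by push_cast; linarith) (hc ▸ h2)
    rw [h1, h3, List.sum_append, List.sum_cons, List.sum_nil, add_zero, ← add_assoc]

/-- **Labels and positions of realized walks.** Under the hypotheses of
`realize_eq_realize_outWalk`, a walk in the label ball of radius `n` realizes to a particle with
the expected label, within `n(1 + α)` of `y(p₀)`. [cite: Theil2006, §4.2 proof of Proposition 4.8 (64) (preprint p. 21); our bookkeeping] -/
theorem apply_realize (hS : ∀ b, dist (y b) (y p₀) < ρ → IsCharted α y Φ b) (hα0 : 0 ≤ α)
    (hα : α < 1) {n : ℕ} (hn : ((n : ℝ) + 1) * (1 + α) < ρ) {l : List (ℤ × ℤ)} (hl : IsWalk l)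
    (hb : InBall (Φ p₀) n (Φ p₀) l) :
    Φ (realize α y Φ p₀ l) = Φ p₀ + l.sum ∧
      dist (y (realize α y Φ p₀ l)) (y p₀) ≤ n * (1 + α) := by
  rw [realize_eq_realize_outWalk hS hα0 hα hn hl hb]
  obtain ⟨hw, hs, -⟩ := outWalk_spec (Φ p₀) (Φ p₀ + l.sum)
  have hlen : (outWalk (Φ p₀) (Φ p₀ + l.sum)).length ≤ n := by
    rw [length_outWalk]
    have := hb.last
    simpa using this
  have hlen' : (((outWalk (Φ p₀) (Φ p₀ + l.sum)).length : ℝ) - 1) * (1 + α) < ρ := by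
    have : ((outWalk (Φ p₀) (Φ p₀ + l.sum)).length : ℝ) ≤ n := by exact_mod_cast hlen
    nlinarith
  obtain ⟨hd, hlab⟩ := realize_track hS hα0 hα hw hlen'
  refine ⟨by rw [hlab, hs]; abel, hd.trans ?_⟩
  have : ((outWalk (Φ p₀) (Φ p₀ + l.sum)).length : ℝ) ≤ n := by exact_mod_cast hlen
  nlinarith

end Region

/-! ### The particles reached by realized walks; injectivity in the large -/

section Reach

variable {X : Type*} {α : ℝ} {y : X → Plane} {Φ : X → ℤ × ℤ}

/-- Enlarging the radius of the ball keeps a walk inside. [cite: Theil2006, §4.2 Definition 4.4 (preprint p. 19); flat model, our bookkeeping] -/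
theorem InBall.mono {c : ℤ × ℤ} {n n' : ℕ} {g : ℤ × ℤ} {l : List (ℤ × ℤ)} (h : InBall c n g l)
    (hn : n ≤ n') : InBall c n' g l := by
  induction l generalizing g with
  | nil => rw [inBall_nil] at h ⊢; exact h.trans hn
  | cons u l ih => rw [inBall_cons] at h ⊢; exact ⟨h.1.trans hn, ih h.2⟩

/-- **The particles reached from `p₀` by realizing the lattice walks of the label ball of radius
`n`** (the domain on which the continued label map is a discrete imbedding).
[cite: Theil2006, §4.2 proof of Proposition 4.8 (64) («Let γ_x … be a discrete path such that
γ_x(K_x) = x. We set Φ(x) = …», preprint p. 21); our bookkeeping] -/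
def reach (α : ℝ) (y : X → Plane) (Φ : X → ℤ × ℤ) (p₀ : X) (n : ℕ) : Set X :=
  {x | ∃ l : List (ℤ × ℤ), IsWalk l ∧ InBall (Φ p₀) n (Φ p₀) l ∧ realize α y Φ p₀ l = x}

variable {p₀ : X} {ρ : ℝ}

/-- `reach` grows with the radius. [cite: Theil2006, §4.2 proof of Proposition 4.8 (64) (preprint p. 21); our bookkeeping] -/
theorem reach_mono {n n' : ℕ} (hn : n ≤ n') : reach α y Φ p₀ n ⊆ reach α y Φ p₀ n' := by
  rintro x ⟨l, hl, hb, rfl⟩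
  exact ⟨l, hl, hb.mono hn, rfl⟩

/-- The realization of the canonical walk to a label of the ball is in `reach`.
[cite: Theil2006, §4.2 proof of Proposition 4.8 (64) (preprint p. 21); our bookkeeping] -/
theorem realize_outWalk_mem_reach {n : ℕ} {η : ℤ × ℤ} (hη : hexNorm (η - Φ p₀) ≤ n) :
    realize α y Φ p₀ (outWalk (Φ p₀) η) ∈ reach α y Φ p₀ n := by
  obtain ⟨hw, -, hb⟩ := outWalk_spec (Φ p₀) η
  exact ⟨_, hw, hb n hη, rfl⟩

/-- **Labels and positions on `reach`.** In a charted region of radius `ρ` around `y(p₀)` with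
`(n + 1)(1 + α) < ρ`, a particle of `reach p₀ n` is the realization of the canonical walk to its
label, lies within `n(1 + α)` of `y(p₀)`, and is charted.
[cite: Theil2006, §4.2 proof of Proposition 4.8 (64) (preprint p. 21); our bookkeeping] -/
theorem mem_reach_iff (hS : ∀ b, dist (y b) (y p₀) < ρ → IsCharted α y Φ b) (hα0 : 0 ≤ α)
    (hα : α < 1) {n : ℕ} (hn : ((n : ℝ) + 1) * (1 + α) < ρ) {x : X} :
    x ∈ reach α y Φ p₀ n ↔
      hexNorm (Φ x - Φ p₀) ≤ n ∧ realize α y Φ p₀ (outWalk (Φ p₀) (Φ x)) = x := by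
  constructor
  · rintro ⟨l, hl, hb, rfl⟩
    obtain ⟨hlab, -⟩ := apply_realize hS hα0 hα hn hl hb
    have h1 := realize_eq_realize_outWalk hS hα0 hα hn hl hb
    refine ⟨?_, ?_⟩
    · rw [hlab, add_sub_cancel_left]
      have := hb.last
      rwa [add_sub_cancel_left] at this
    · rw [hlab, ← h1]
  · rintro ⟨hx, hr⟩
    rw [← hr]
    exact realize_outWalk_mem_reach hx

/-- Particles of `reach p₀ n` lie within `n(1 + α)` of `y(p₀)` (hypotheses of `mem_reach_iff`).
[cite: Theil2006, §4.2 proof of Proposition 4.8 (64) (preprint p. 21); our bookkeeping] -/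
theorem dist_le_of_mem_reach (hS : ∀ b, dist (y b) (y p₀) < ρ → IsCharted α y Φ b) (hα0 : 0 ≤ α)
    (hα : α < 1) {n : ℕ} (hn : ((n : ℝ) + 1) * (1 + α) < ρ) {x : X}
    (hx : x ∈ reach α y Φ p₀ n) : dist (y x) (y p₀) ≤ n * (1 + α) := by
  obtain ⟨l, hl, hb, rfl⟩ := hx
  exact (apply_realize hS hα0 hα hn hl hb).2

/-- **Injectivity in the large from injectivity in the small: `Φ` is a discrete imbedding of
`reach p₀ n`** when every particle within `ρ` of `y(p₀)` is charted and `(n + 1)(1 + α) < ρ`.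
Injectivity: two particles of `reach` with the same label are both the realization of the
canonical walk to that label (`realize_eq_realize_outWalk`, i.e. Lemma 4.6); (19) and (20) hold
inside the charted wheel of the first particle. [cite: Theil2006, §4.2 proof of Proposition 4.8
(«Next we show that Φ is a discrete imbedding … Lemma 4.6 implies that the definition of Φ(x) is
independent of the choice of γ_x», preprint p. 21); our combinatorial form] -/
theorem isDiscreteImbeddingOn_reach (hS : ∀ b, dist (y b) (y p₀) < ρ → IsCharted α y Φ b)
    (hα0 : 0 ≤ α) (hα : α < 1) {n : ℕ} (hn : ((n : ℝ) + 1) * (1 + α) < ρ) :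
    IsDiscreteImbeddingOn α y (reach α y Φ p₀ n) Φ := by
  have hch : ∀ x ∈ reach α y Φ p₀ n, IsCharted α y Φ x := fun x hx =>
    hS x (by have := dist_le_of_mem_reach hS hα0 hα hn hx; nlinarith)
  refine ⟨?_, ?_, ?_⟩
  · intro x hx x' _ hs
    exact (hch x hx).2.continuousOn (mem_nbhdSet_self x) hs.mem_nbhdSet hs
  · intro x₁ h₁ x₂ _ x₃ _ s₁₂ s₁₃ s₂₃
    exact (hch x₁ h₁).2.orientationOn (mem_nbhdSet_self x₁) s₁₂.mem_nbhdSet s₁₃.mem_nbhdSet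
      s₁₂ s₁₃ s₂₃
  · intro x hx x' hx' heq
    obtain ⟨-, hr⟩ := (mem_reach_iff hS hα0 hα hn).1 hx
    obtain ⟨-, hr'⟩ := (mem_reach_iff hS hα0 hα hn).1 hx'
    rw [← hr, ← hr', heq]

/-- **Neighbourhoods of realized labels stay in `reach`.** For a label `η` with
`hexNorm(η − Φ(p₀)) ≤ n` (charted region, `(n + 1)(1 + α) < ρ`), the particle
`p = realize(out η)` carries the label `η`, is not a defect, and `𝒩(p) ⊆ reach p₀ (n + 1)`.
[cite: Theil2006, §4.2 proof of Proposition 4.8 (3) (62) with Remark 2.5 (preprint pp. 7, 21); our bookkeeping] -/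
theorem realize_outWalk_spec (hS : ∀ b, dist (y b) (y p₀) < ρ → IsCharted α y Φ b) (hα0 : 0 ≤ α)
    (hα : α < 1) {n : ℕ} (hn : ((n : ℝ) + 1) * (1 + α) < ρ) {η : ℤ × ℤ}
    (hη : hexNorm (η - Φ p₀) ≤ n) :
    Φ (realize α y Φ p₀ (outWalk (Φ p₀) η)) = η ∧
      realize α y Φ p₀ (outWalk (Φ p₀) η) ∉ defectSet α y ∧
      nbhdSet α y (realize α y Φ p₀ (outWalk (Φ p₀) η)) ⊆ reach α y Φ p₀ (n + 1) := by
  obtain ⟨hw, hs, hb⟩ := outWalk_spec (Φ p₀) η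
  obtain ⟨hlab, hd⟩ := apply_realize hS hα0 hα hn hw (hb n hη)
  rw [hs, add_sub_cancel] at hlab
  set p := realize α y Φ p₀ (outWalk (Φ p₀) η) with hp
  have hpc : IsCharted α y Φ p := hS p (by nlinarith)
  refine ⟨hlab, hpc.not_mem_defectSet hα, fun b hb' => ?_⟩
  rw [mem_nbhdSet_iff] at hb'
  rcases hb' with rfl | hb'
  · exact reach_mono (Nat.le_succ n) (realize_outWalk_mem_reach hη)
  · -- `b` is reached by `out η` followed by the step `Φ b − η`
    have hu : Φ b - Φ p ∈ unitShell := hpc.sub_mem_unitShell hα hb'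
    refine ⟨outWalk (Φ p₀) η ++ [Φ b - Φ p], isWalk_append.2 ⟨hw, isWalk_cons.2 ⟨hu, isWalk_nil⟩⟩,
      ?_, ?_⟩
    · rw [inBall_append, hs, add_sub_cancel, inBall_cons, inBall_nil]
      refine ⟨(hb n hη).mono (Nat.le_succ n), hη.trans (Nat.le_succ n), ?_⟩
      rw [hlab, add_sub_cancel]
      have := hexNorm_add_le_succ hu (η - Φ p₀)
      have e : η - Φ p₀ + (Φ b - Φ p) = Φ b - Φ p₀ := by rw [hlab]; abel
      rw [e] at this
      omega
    · rw [realize_append, ← hp, realize_cons, realize_nil, add_sub_cancel]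
      exact hpc.nextP_eq hb' rfl

end Reach

/-! ### Bond chains through charted particles -/

section Chains

variable {X : Type*} {α : ℝ} {y : X → Plane} {Φ : X → ℤ × ℤ}

/-- A **charted step**: a bond `{a, b} ∈ 𝒮(y)` leaving a charted particle `a`.
[cite: Theil2006, §4.2 proof of Proposition 4.8 (64) (preprint p. 21); our bookkeeping] -/
def ChartedStep (α : ℝ) (y : X → Plane) (Φ : X → ℤ × ℤ) (a b : X) : Prop :=
  IsCharted α y Φ a ∧ IsShortRange α y a b

/-- The endpoint of a chain of particles listed after its start. [cite: Theil2006, §4.2 proof of Proposition 4.8 (64) («γ_x(K_x) = x», preprint p. 21); our bookkeeping] -/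
def chainEnd : X → List X → X
  | q, [] => q
  | _, b :: ps => chainEnd b ps

/-- The label increments along a chain of particles (the lattice walk it traces under `Φ`).
[cite: Theil2006, §4.2 proof of Proposition 4.8 (64) (preprint p. 21); our bookkeeping] -/
def labelWalk (Φ : X → ℤ × ℤ) : X → List X → List (ℤ × ℤ)
  | _, [] => []
  | q, b :: ps => (Φ b - Φ q) :: labelWalk Φ b ps

/-- The label walk of a chain stays in a ball iff the labels of the chain do. [cite: Theil2006, §4.2 proof of Proposition 4.8 (64) (preprint p. 21); our bookkeeping] -/
theorem inBall_labelWalk_iff {c : ℤ × ℤ} {n : ℕ} (q : X) (ps : List X) :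
    InBall c n (Φ q) (labelWalk Φ q ps) ↔
      hexNorm (Φ q - c) ≤ n ∧ ∀ b ∈ ps, hexNorm (Φ b - c) ≤ n := by
  induction ps generalizing q with
  | nil => simp [labelWalk, inBall_nil]
  | cons b ps ih =>
    rw [labelWalk, inBall_cons, add_sub_cancel, ih]
    simp only [List.mem_cons, forall_eq_or_imp]

/-- **A bond chain through charted particles is the realization of its label walk** (and its
label walk is a lattice walk). [cite: Theil2006, §4.2 proof of Proposition 4.8 (64) (preprint p. 21); our bookkeeping] -/
theorem realize_labelWalk (hα : α < 1) {q : X} {ps : List X}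
    (hc : List.IsChain (ChartedStep α y Φ) (q :: ps)) :
    realize α y Φ q (labelWalk Φ q ps) = chainEnd q ps ∧ IsWalk (labelWalk Φ q ps) := by
  induction ps generalizing q with
  | nil => exact ⟨rfl, isWalk_nil⟩
  | cons b ps ih =>
    rw [List.isChain_cons_cons] at hc
    obtain ⟨⟨hq, hqb⟩, hc'⟩ := hc
    obtain ⟨h1, h2⟩ := ih hc'
    refine ⟨?_, isWalk_cons.2 ⟨hq.sub_mem_unitShell hα hqb, h2⟩⟩
    rw [labelWalk, realize_cons, add_sub_cancel, hq.nextP_eq hqb rfl, h1, chainEnd]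

/-- **Bond chains land in `reach`**: the endpoint of a bond chain from `p₀` through charted
particles, all of whose labels lie in the label ball of radius `n`, is in `reach p₀ n`.
[cite: Theil2006, §4.2 proof of Proposition 4.8 (64) (preprint p. 21); our bookkeeping] -/
theorem chainEnd_mem_reach (hα : α < 1) {p₀ : X} {n : ℕ} {ps : List X}
    (hc : List.IsChain (ChartedStep α y Φ) (p₀ :: ps))
    (hlab : ∀ b ∈ ps, hexNorm (Φ b - Φ p₀) ≤ n) : chainEnd p₀ ps ∈ reach α y Φ p₀ n := by
  obtain ⟨hr, hw⟩ := realize_labelWalk hα hc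
  refine ⟨labelWalk Φ p₀ ps, hw, ?_, hr⟩
  rw [inBall_labelWalk_iff]
  exact ⟨by rw [sub_self]; simp [hexNorm], hlab⟩

end Chains

end Theil2006

end Literature.MathematicalPhysics.StatisticalMechanics
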